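import Literature.MathematicalPhysics.QuantumLattice.TorusWilsonMarkov
import Literature.Probability.Moments.ExplainedVarianceCondExp
import HarnessLib

/-!
# Crux `IR` (stmt-QuantumFields-19354) — merged maxcorr line «maximal correlation at one physical thickness»:
support ENGINE (T1) «tensorisation of maximal correlation», part 2a — the two formats and their transport

Helper module for item `stmt-QuantumFields-19354` (`--supports`; it closes nothing).  Second of three files proving
the typed support statement `Tensorisation.TensorisationEngine` of the merged line's workfile
`Cruxes/IR/Lines/tensorisation_engine.lean` (ideator ym-ir-idea-1 g0, MECHANISM card §4; Witsenhausen, SIAM J. Appl.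
Math. 28 (1975) Thm. 1 / Kumar's lemma): maximal correlation TENSORISES over independent pairs of σ-algebras.
Part 1 is `…ShellMaxCorrTensorisationLaw.lean` (the two-block Fubini lemma); part 2b `…ShellMaxCorrTensorisation.lean`
assembles the engine.

Contents (one probability space `(Ω, m0, μ)`, sub-σ-algebras `mX, mZ ≤ m0`):
* §1 the covariance format `|Cov(u,v)| ≤ ρ σ(u) σ(v)` (bounded `mX`-measurable `u`, `mZ`-measurable `v`) in the
  degenerate case `mX = ⊥`;
* §2 equivalence of the covariance format with the workfile's OPERATOR format
  `‖P_X P_Z f − 𝔼f‖₂² ≤ ρ² ‖f − 𝔼f‖₂²` (`cov_le_of_opBound`, `opBound_of_cov_le`; explained variance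
  `Literature.Probability.Moments.sq_cov_le_var_condExp_mul_var`, pull-out, `L²`-contraction of `P_Z`);
* §3 transport of the covariance format along a measurable map `φ : Ω → β`: pulled-back algebras under `μ` ⇔ the
  algebras under the image law `μ.map φ` (`covBound_map_of_comap`, `covBound_comap_of_map`; Doob–Dynkin
  `Measurable.exists_eq_measurable_comp` + truncation).

Technical note (recorded because it decides what the workfile's statement SAYS): with several `MeasurableSpace Ω`
binders in scope, instance resolution takes the LAST one; here the sub-σ-algebras are declared before the ambient
`m0` (Mathlib idiom), and lemmas at non-ambient σ-algebras are applied with explicit structure arguments.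

HONEST FRAMING: abstract probability (a group-blind support engine of a CONDITIONAL rung line); it proves nothing
about Yang–Mills.  `BalabanLadder.IR` is NOT proved; the Clay YM mass gap is NOT proved; R4 closes only the
conditional finite-𝕋⁴ rung `BalabanLadder.UV`.
-/

set_option autoImplicit false

noncomputable section

open MeasureTheory ProbabilityTheory
open Literature.MathematicalPhysics.QuantumLattice

namespace Summit.QuantumFields.YangMills.Cruxes.IR.ShellMaxCorr.Tensorisation

-- sub-σ-algebras are declared BEFORE the ambient `m0`, so that instance resolution picks `m0` (Mathlib idiom)
variable {Ω : Type*} {mX mZ mA₁ mC₁ mA₂ mC₂ : MeasurableSpace Ω} {m0 : MeasurableSpace Ω} {μ : Measure Ω}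

/-! ## §1 The covariance form on a probability space: degenerate algebra, bounded statistics -/

/-- A real function measurable for the trivial σ-algebra `⊥` is constant. -/
theorem apply_eq_of_measurable_bot {u : Ω → ℝ} (hu : Measurable[⊥] u) (ω ω' : Ω) : u ω = u ω' := by
  have hs : MeasurableSet[⊥] (u ⁻¹' {u ω'}) := hu (measurableSet_singleton _)
  rcases MeasurableSpace.measurableSet_bot_iff.1 hs with h | h
  · have : ω' ∈ u ⁻¹' {u ω'} := rfl
    rw [h] at this
    exact absurd this (Set.notMem_empty _)
  · have : ω ∈ u ⁻¹' {u ω'} := by rw [h]; exact Set.mem_univ _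
    exact this

/-- The covariance bound `|Cov(u,v)| ≤ ρ σ(u) σ(v)` holds trivially when `u` is `⊥`-measurable (constant). -/
theorem cov_le_of_measurable_bot [IsProbabilityMeasure μ] {ρ : ℝ} (hρ : 0 ≤ ρ) {u : Ω → ℝ}
    (hu : Measurable[⊥] u) (v : Ω → ℝ) :
    |(∫ ω, u ω * v ω ∂μ) - (∫ ω, u ω ∂μ) * (∫ ω, v ω ∂μ)| ≤
      ρ * Real.sqrt (∫ ω, (u ω - ∫ ω', u ω' ∂μ) ^ 2 ∂μ) * Real.sqrt (∫ ω, (v ω - ∫ ω', v ω' ∂μ) ^ 2 ∂μ) := by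
  rcases isEmpty_or_nonempty Ω with hΩ | ⟨⟨ω₀⟩⟩
  · exfalso
    have h := measure_univ (μ := μ)
    rw [Set.univ_eq_empty_iff.mpr hΩ, measure_empty] at h
    exact zero_ne_one h
  · have hc : u = fun _ => u ω₀ := funext fun ω => apply_eq_of_measurable_bot hu ω ω₀
    have h1 : ∫ ω, u ω * v ω ∂μ = u ω₀ * ∫ ω, v ω ∂μ := by
      rw [hc, integral_const_mul]
    have h2 : ∫ ω, u ω ∂μ = u ω₀ := by rw [hc]; simp
    rw [h1, h2, sub_self, abs_zero]
    positivity

/-! ## §2 Operator format ⇔ covariance format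

Operator format (the workfile's `MaxCorrLE μ mX mZ ρ`): `‖P_X P_Z f − 𝔼f‖₂² ≤ ρ² ‖f − 𝔼f‖₂²` for bounded
measurable `f`.  Covariance format: `|Cov(u,v)| ≤ ρ σ(u) σ(v)` for bounded `mX`-measurable `u` and `mZ`-measurable
`v`.  They are equivalent for `0 ≤ ρ` (`P_X`, `P_Z` are the `L²`-projections onto the two algebras). -/

section Formats

variable [IsProbabilityMeasure μ]

/-- `∫ (g − ∫ g)² = ∫ g² − (∫ g)²` for an integrable `g` with integrable square (probability space). -/
theorem integral_sub_mean_sq {g : Ω → ℝ} (hg : Integrable g μ) (hg2 : Integrable (fun ω => g ω ^ 2) μ) :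
    ∫ ω, (g ω - ∫ ω', g ω' ∂μ) ^ 2 ∂μ = (∫ ω, g ω ^ 2 ∂μ) - (∫ ω, g ω ∂μ) ^ 2 := by
  set c := ∫ ω', g ω' ∂μ with hc
  have hexp : (fun ω => (g ω - c) ^ 2) = fun ω => g ω ^ 2 - 2 * c * g ω + c ^ 2 := by
    funext ω; ring
  have h1 : ∫ ω, (g ω ^ 2 - 2 * c * g ω + c ^ 2) ∂μ = (∫ ω, (g ω ^ 2 - 2 * c * g ω) ∂μ) + ∫ _ω, c ^ 2 ∂μ :=
    integral_add (hg2.sub (hg.const_mul _)) (integrable_const _)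
  have h2 : ∫ ω, (g ω ^ 2 - 2 * c * g ω) ∂μ = (∫ ω, g ω ^ 2 ∂μ) - ∫ ω, 2 * c * g ω ∂μ :=
    integral_sub hg2 (hg.const_mul _)
  rw [hexp, h1, h2, integral_const_mul]
  simp only [integral_const, probReal_univ, smul_eq_mul, one_mul]
  ring

/-- **Operator format ⇒ covariance format.**  If `‖P_X P_Z f − 𝔼f‖₂ ≤ ρ ‖f − 𝔼f‖₂` for all bounded
`mZ`-measurable `f` (the weakest form of the operator format: `P_Z f = f` there), then `|Cov(u,v)| ≤ ρ σ(u) σ(v)` for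
bounded `mX`-measurable `u` and `mZ`-measurable `v` (explained variance `Cov(u,v)² ≤ Var(P_X v)·Var(u)` and
`Var(P_X v) ≤ ρ² Var v`). -/
theorem cov_le_of_opBound (hX : mX ≤ m0) (hZ : mZ ≤ m0) {ρ : ℝ} (hρ : 0 ≤ ρ)
    (H : ∀ f : Ω → ℝ, Measurable[mZ] f → (∃ M : ℝ, ∀ ω, |f ω| ≤ M) →
      ∫ ω, ((μ[μ[f|mZ]|mX]) ω - ∫ ω', f ω' ∂μ) ^ 2 ∂μ ≤ ρ ^ 2 * ∫ ω, (f ω - ∫ ω', f ω' ∂μ) ^ 2 ∂μ)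
    {u v : Ω → ℝ} (hu : Measurable[mX] u) (hv : Measurable[mZ] v) {Mu Mv : ℝ}
    (hMu : ∀ ω, |u ω| ≤ Mu) (hMv : ∀ ω, |v ω| ≤ Mv) :
    |(∫ ω, u ω * v ω ∂μ) - (∫ ω, u ω ∂μ) * (∫ ω, v ω ∂μ)| ≤
      ρ * Real.sqrt (∫ ω, (u ω - ∫ ω', u ω' ∂μ) ^ 2 ∂μ) * Real.sqrt (∫ ω, (v ω - ∫ ω', v ω' ∂μ) ^ 2 ∂μ) := by
  have hum : Measurable u := hu.mono hX le_rfl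
  have hvm : Measurable v := hv.mono hZ le_rfl
  have hui : Integrable u μ := integrable_of_ae_bdd_abs hum.aestronglyMeasurable (ae_of_all _ hMu)
  have hvi : Integrable v μ := integrable_of_ae_bdd_abs hvm.aestronglyMeasurable (ae_of_all _ hMv)
  have hu2 : Integrable (fun ω => u ω ^ 2) μ := integrable_sq_of_ae_bdd_abs hum.aestronglyMeasurable (ae_of_all _ hMu)
  have hv2 : Integrable (fun ω => v ω ^ 2) μ := integrable_sq_of_ae_bdd_abs hvm.aestronglyMeasurable (ae_of_all _ hMv)
  -- `P_Z v = v`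
  have hvZ : μ[v|mZ] = v := condExp_of_stronglyMeasurable hZ hv.stronglyMeasurable hvi
  -- the operator bound for `v`: `Var(P_X v) ≤ ρ² Var(v)`
  have hop : ∫ ω, ((μ[v|mX]) ω - ∫ ω', v ω' ∂μ) ^ 2 ∂μ ≤ ρ ^ 2 * ∫ ω, (v ω - ∫ ω', v ω' ∂μ) ^ 2 ∂μ := by
    have := H v hv ⟨Mv, hMv⟩
    rwa [hvZ] at this
  set F : Ω → ℝ := μ[v|mX] with hF
  have hFi : Integrable F μ := integrable_condExp
  have hFb : ∀ᵐ ω ∂μ, |F ω| ≤ Mv := ae_bdd_abs_condExp_of_ae_bdd_abs (ae_of_all _ hMv)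
  have hF2 : Integrable (fun ω => F ω ^ 2) μ := integrable_sq_of_ae_bdd_abs hFi.aestronglyMeasurable hFb
  have hFmean : ∫ ω, F ω ∂μ = ∫ ω, v ω ∂μ := integral_condExp hX
  -- explained variance: `Cov(v,u)² ≤ Var(P_X v) Var(u)`
  have hev := Literature.Probability.Moments.sq_cov_le_var_condExp_mul_var (μ := μ) hX hvm.aestronglyMeasurable
    hu.stronglyMeasurable (ae_of_all _ hMv) (ae_of_all _ hMu)
  -- variances in centred form
  have hVu : ∫ ω, (u ω - ∫ ω', u ω' ∂μ) ^ 2 ∂μ = (∫ ω, u ω ^ 2 ∂μ) - (∫ ω, u ω ∂μ) ^ 2 :=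
    integral_sub_mean_sq hui hu2
  have hVv : ∫ ω, (v ω - ∫ ω', v ω' ∂μ) ^ 2 ∂μ = (∫ ω, v ω ^ 2 ∂μ) - (∫ ω, v ω ∂μ) ^ 2 :=
    integral_sub_mean_sq hvi hv2
  have hVF : ∫ ω, (F ω - ∫ ω', v ω' ∂μ) ^ 2 ∂μ = (∫ ω, F ω ^ 2 ∂μ) - (∫ ω, v ω ∂μ) ^ 2 := by
    rw [← hFmean]; exact integral_sub_mean_sq hFi hF2
  set A := ∫ ω, (u ω - ∫ ω', u ω' ∂μ) ^ 2 ∂μ with hA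
  set B := ∫ ω, (v ω - ∫ ω', v ω' ∂μ) ^ 2 ∂μ with hB
  have hA0 : 0 ≤ A := integral_nonneg fun ω => sq_nonneg _
  have hB0 : 0 ≤ B := integral_nonneg fun ω => sq_nonneg _
  set C := (∫ ω, u ω * v ω ∂μ) - (∫ ω, u ω ∂μ) * (∫ ω, v ω ∂μ) with hC
  have hC' : (∫ ω, v ω * u ω ∂μ) - (∫ ω, v ω ∂μ) * (∫ ω, u ω ∂μ) = C := by
    rw [hC, mul_comm (∫ ω, v ω ∂μ)]
    congr 1
    exact integral_congr_ae (ae_of_all _ fun ω => mul_comm _ _)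
  have hsq : C ^ 2 ≤ ρ ^ 2 * A * B := by
    rw [hC'] at hev
    rw [← hVu, ← hVF] at hev
    calc C ^ 2 ≤ (∫ ω, (F ω - ∫ ω', v ω' ∂μ) ^ 2 ∂μ) * A := hev
      _ ≤ (ρ ^ 2 * B) * A := mul_le_mul_of_nonneg_right hop hA0
      _ = ρ ^ 2 * A * B := by ring
  calc |C| ≤ Real.sqrt (ρ ^ 2 * A * B) := Real.abs_le_sqrt hsq
    _ = ρ * Real.sqrt A * Real.sqrt B := by
        rw [Real.sqrt_mul (by positivity), Real.sqrt_mul (by positivity), Real.sqrt_sq hρ]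

/-- **Covariance format ⇒ operator format.**  If `|Cov(u,v)| ≤ ρ σ(u) σ(v)` for bounded `mX`-measurable `u` and
`mZ`-measurable `v`, then `‖P_X P_Z f − 𝔼f‖₂² ≤ ρ² ‖f − 𝔼f‖₂²` for every bounded measurable `f`
(with `v := P_Z f`, `u := P_X v`: `‖u − 𝔼u‖₂² = Cov(u,v) ≤ ρ ‖u − 𝔼u‖₂ ‖v − 𝔼v‖₂` and `‖v − 𝔼v‖₂ ≤ ‖f − 𝔼f‖₂`). -/
theorem opBound_of_cov_le (hX : mX ≤ m0) (hZ : mZ ≤ m0) {ρ : ℝ} (hρ : 0 ≤ ρ)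
    (H : ∀ u v : Ω → ℝ, Measurable[mX] u → Measurable[mZ] v → (∃ M : ℝ, ∀ ω, |u ω| ≤ M) →
      (∃ M : ℝ, ∀ ω, |v ω| ≤ M) →
      |(∫ ω, u ω * v ω ∂μ) - (∫ ω, u ω ∂μ) * (∫ ω, v ω ∂μ)| ≤
        ρ * Real.sqrt (∫ ω, (u ω - ∫ ω', u ω' ∂μ) ^ 2 ∂μ) * Real.sqrt (∫ ω, (v ω - ∫ ω', v ω' ∂μ) ^ 2 ∂μ))
    {f : Ω → ℝ} (hf : Measurable f) {M : ℝ} (hM : ∀ ω, |f ω| ≤ M) :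
    ∫ ω, ((μ[μ[f|mZ]|mX]) ω - ∫ ω', f ω' ∂μ) ^ 2 ∂μ ≤ ρ ^ 2 * ∫ ω, (f ω - ∫ ω', f ω' ∂μ) ^ 2 ∂μ := by
  have hfi : Integrable f μ := integrable_of_ae_bdd_abs hf.aestronglyMeasurable (ae_of_all _ hM)
  -- `v` : an everywhere bounded `mZ`-measurable version of `P_Z f`
  obtain ⟨v, hvsm, hvM, hvEq⟩ :=
    exists_stronglyMeasurable_truncation (stronglyMeasurable_condExp (m := mZ) (μ := μ) (f := f)) M
  have hv_ae : (μ[f|mZ]) =ᵐ[μ] v :=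
    (ae_bdd_abs_condExp_of_ae_bdd_abs (m := mZ) (ae_of_all μ hM)).mono fun ω hω => (hvEq ω hω).symm
  have hvm : Measurable v := (hvsm.mono hZ).measurable
  have hvi : Integrable v μ := integrable_of_ae_bdd_abs hvm.aestronglyMeasurable (ae_of_all _ hvM)
  -- `u` : an everywhere bounded `mX`-measurable version of `P_X v`
  obtain ⟨u, husm, huM, huEq⟩ :=
    exists_stronglyMeasurable_truncation (stronglyMeasurable_condExp (m := mX) (μ := μ) (f := v)) |M|
  have hu_ae : (μ[v|mX]) =ᵐ[μ] u :=
    (ae_bdd_abs_condExp_of_ae_bdd_abs (m := mX) (ae_of_all μ hvM)).mono fun ω hω => (huEq ω hω).symm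
  replace huM : ∀ ω, |u ω| ≤ |M| := fun ω => (huM ω).trans_eq (abs_abs M)
  have hum : Measurable u := (husm.mono hX).measurable
  have hui : Integrable u μ := integrable_of_ae_bdd_abs hum.aestronglyMeasurable (ae_of_all _ huM)
  have hu2 : Integrable (fun ω => u ω ^ 2) μ := integrable_sq_of_ae_bdd_abs hum.aestronglyMeasurable (ae_of_all _ huM)
  -- means
  set c := ∫ ω', f ω' ∂μ with hc
  have hmean_v : ∫ ω, v ω ∂μ = c := ((integral_congr_ae hv_ae).symm.trans (integral_condExp hZ))
  have hmean_u : ∫ ω, u ω ∂μ = c := by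
    rw [← hmean_v]; exact (integral_congr_ae hu_ae).symm.trans (integral_condExp hX)
  -- the left-hand side is `∫ (u − c)²`
  have hLHS : μ[μ[f|mZ]|mX] =ᵐ[μ] u := (condExp_congr_ae hv_ae).trans hu_ae
  have hL : ∫ ω, ((μ[μ[f|mZ]|mX]) ω - c) ^ 2 ∂μ = ∫ ω, (u ω - c) ^ 2 ∂μ :=
    integral_congr_ae (hLHS.mono fun ω hω => by simp only [hω])
  -- `∫ u v = ∫ u²` (pull-out + tower)
  have hpull : μ[u * v|mX] =ᵐ[μ] u * μ[v|mX] :=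
    condExp_stronglyMeasurable_mul_of_bound hX husm hvi |M|
      ((ae_of_all μ huM).mono fun ω h => by rwa [Real.norm_eq_abs])
  have huv : ∫ ω, u ω * v ω ∂μ = ∫ ω, u ω ^ 2 ∂μ := by
    calc ∫ ω, u ω * v ω ∂μ = ∫ ω, (u * v) ω ∂μ := integral_congr_ae (ae_of_all _ fun ω => rfl)
      _ = ∫ ω, (μ[u * v|mX]) ω ∂μ := (integral_condExp hX).symm
      _ = ∫ ω, u ω * (μ[v|mX]) ω ∂μ := integral_congr_ae (hpull.mono fun ω hω => by simpa using hω)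
      _ = ∫ ω, u ω * u ω ∂μ := integral_congr_ae (hu_ae.mono fun ω hω => by simp only [hω])
      _ = ∫ ω, u ω ^ 2 ∂μ := integral_congr_ae (ae_of_all _ fun ω => by simp only [sq])
  -- `σ_u² = Cov(u,v)`
  set A := ∫ ω, (u ω - ∫ ω', u ω' ∂μ) ^ 2 ∂μ with hA
  set B := ∫ ω, (v ω - ∫ ω', v ω' ∂μ) ^ 2 ∂μ with hB
  have hA0 : 0 ≤ A := integral_nonneg fun ω => sq_nonneg _
  have hB0 : 0 ≤ B := integral_nonneg fun ω => sq_nonneg _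
  have hAcov : A = (∫ ω, u ω * v ω ∂μ) - (∫ ω, u ω ∂μ) * (∫ ω, v ω ∂μ) := by
    rw [hA, integral_sub_mean_sq hui hu2, huv, hmean_u, hmean_v, sq]
  -- the covariance bound for the pair `(u, v)`
  have hH := H u v husm.measurable hvsm.measurable ⟨|M|, huM⟩ ⟨|M|, hvM⟩
  rw [← hAcov, abs_of_nonneg hA0] at hH
  -- `A ≤ ρ² B`
  have hAB : A ≤ ρ ^ 2 * B := by
    have hsA : Real.sqrt A * Real.sqrt A = A := Real.mul_self_sqrt hA0
    have hsB : Real.sqrt B * Real.sqrt B = B := Real.mul_self_sqrt hB0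
    rcases (Real.sqrt_nonneg A).lt_or_eq with hpos | hzero
    · have h1 : Real.sqrt A ≤ ρ * Real.sqrt B := by
        have : Real.sqrt A * Real.sqrt A ≤ (ρ * Real.sqrt B) * Real.sqrt A := by
          rw [hsA]; linarith [hH]
        exact le_of_mul_le_mul_right this hpos
      calc A = Real.sqrt A * Real.sqrt A := hsA.symm
        _ ≤ (ρ * Real.sqrt B) * (ρ * Real.sqrt B) :=
            mul_le_mul h1 h1 (Real.sqrt_nonneg _) (by positivity)
        _ = ρ ^ 2 * (Real.sqrt B * Real.sqrt B) := by ring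
        _ = ρ ^ 2 * B := by rw [hsB]
    · have hA' : A = 0 := by rw [← hsA, ← hzero, mul_zero]
      rw [hA']; positivity
  -- `B ≤ ∫ (f − c)²` (conditional expectation contracts `L²`)
  have hBf : B ≤ ∫ ω, (f ω - c) ^ 2 ∂μ := by
    have h1 : B = ∫ ω, ((μ[f|mZ]) ω - c) ^ 2 ∂μ := by
      rw [hB, hmean_v]
      exact integral_congr_ae (hv_ae.mono fun ω hω => by
        show (v ω - c) ^ 2 = ((μ[f|mZ]) ω - c) ^ 2
        rw [hω])
    have h2 : ∀ᵐ ω ∂μ, ((μ[f|mZ]) ω - c) ^ 2 = ((μ[fun ω => f ω - c|mZ]) ω) ^ 2 := by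
      have hsub := condExp_sub hfi (integrable_const c) mZ
      rw [condExp_const hZ c] at hsub
      filter_upwards [hsub] with ω hω
      have e : (fun ω => f ω - c) = f - fun _ => c := rfl
      have : (μ[fun ω => f ω - c|mZ]) ω = (μ[f|mZ]) ω - c := by rw [e, hω]; rfl
      rw [this]
    rw [h1, integral_congr_ae h2]
    have hb : ∀ᵐ ω ∂μ, |f ω - c| ≤ M + |c| := ae_of_all _ fun ω =>
      (abs_sub _ _).trans (add_le_add (hM ω) le_rfl)
    exact integral_condExp_sq_le_of_ae_bdd (hf.sub measurable_const).aestronglyMeasurable hb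
  rw [hL]
  calc ∫ ω, (u ω - c) ^ 2 ∂μ = A := by rw [hA, hmean_u]
    _ ≤ ρ ^ 2 * B := hAB
    _ ≤ ρ ^ 2 * ∫ ω, (f ω - c) ^ 2 ∂μ := mul_le_mul_of_nonneg_left hBf (by positivity)

end Formats

/-! ## §3 Transport of the covariance format along a measurable map

For a measurable `φ : Ω → β` the covariance format for the pulled-back algebras `φ⁻¹ mX'`, `φ⁻¹ mZ'` under `μ`
is equivalent to the covariance format for `mX'`, `mZ'` under the image law `μ ∘ φ⁻¹` (forward: composition;
backward: Doob–Dynkin factorisation `Measurable.exists_eq_measurable_comp` + truncation). -/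

section Transport

variable {β : Type*} {mX' mZ' : MeasurableSpace β} {mβ : MeasurableSpace β} {φ : Ω → β}

/-- **Forward transport**: the covariance bound for `(φ⁻¹ mX', φ⁻¹ mZ')` under `μ` gives the covariance bound for
`(mX', mZ')` under `μ.map φ`. -/
theorem covBound_map_of_comap (hφ : Measurable φ) (hX' : mX' ≤ mβ) (hZ' : mZ' ≤ mβ) {ρ : ℝ}
    (H : ∀ u v : Ω → ℝ, Measurable[mX'.comap φ] u → Measurable[mZ'.comap φ] v →
      (∃ M : ℝ, ∀ ω, |u ω| ≤ M) → (∃ M : ℝ, ∀ ω, |v ω| ≤ M) →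
      |(∫ ω, u ω * v ω ∂μ) - (∫ ω, u ω ∂μ) * (∫ ω, v ω ∂μ)| ≤
        ρ * Real.sqrt (∫ ω, (u ω - ∫ ω', u ω' ∂μ) ^ 2 ∂μ) * Real.sqrt (∫ ω, (v ω - ∫ ω', v ω' ∂μ) ^ 2 ∂μ))
    {u' v' : β → ℝ} (hu' : Measurable[mX'] u') (hv' : Measurable[mZ'] v')
    (hbu : ∃ M : ℝ, ∀ x, |u' x| ≤ M) (hbv : ∃ M : ℝ, ∀ x, |v' x| ≤ M) :
    |(∫ x, u' x * v' x ∂(μ.map φ)) - (∫ x, u' x ∂(μ.map φ)) * (∫ x, v' x ∂(μ.map φ))| ≤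
      ρ * Real.sqrt (∫ x, (u' x - ∫ x', u' x' ∂(μ.map φ)) ^ 2 ∂(μ.map φ))
        * Real.sqrt (∫ x, (v' x - ∫ x', v' x' ∂(μ.map φ)) ^ 2 ∂(μ.map φ)) := by
  have hu'm : Measurable u' := hu'.mono hX' le_rfl
  have hv'm : Measurable v' := hv'.mono hZ' le_rfl
  have e1 : ∫ x, u' x * v' x ∂(μ.map φ) = ∫ ω, u' (φ ω) * v' (φ ω) ∂μ :=
    integral_map_of_stronglyMeasurable hφ (hu'm.mul hv'm).stronglyMeasurable
  have e2 : ∫ x, u' x ∂(μ.map φ) = ∫ ω, u' (φ ω) ∂μ :=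
    integral_map_of_stronglyMeasurable hφ hu'm.stronglyMeasurable
  have e3 : ∫ x, v' x ∂(μ.map φ) = ∫ ω, v' (φ ω) ∂μ :=
    integral_map_of_stronglyMeasurable hφ hv'm.stronglyMeasurable
  rw [e1, e2, e3]
  have e4 : ∫ x, (u' x - ∫ ω, u' (φ ω) ∂μ) ^ 2 ∂(μ.map φ) = ∫ ω, (u' (φ ω) - ∫ ω, u' (φ ω) ∂μ) ^ 2 ∂μ :=
    integral_map_of_stronglyMeasurable hφ ((hu'm.sub measurable_const).pow_const 2).stronglyMeasurable
  have e5 : ∫ x, (v' x - ∫ ω, v' (φ ω) ∂μ) ^ 2 ∂(μ.map φ) = ∫ ω, (v' (φ ω) - ∫ ω, v' (φ ω) ∂μ) ^ 2 ∂μ :=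
    integral_map_of_stronglyMeasurable hφ ((hv'm.sub measurable_const).pow_const 2).stronglyMeasurable
  rw [e4, e5]
  have hφX : @Measurable Ω β (mX'.comap φ) mX' φ := measurable_iff_comap_le.2 le_rfl
  have hφZ : @Measurable Ω β (mZ'.comap φ) mZ' φ := measurable_iff_comap_le.2 le_rfl
  obtain ⟨Mu, hMu⟩ := hbu
  obtain ⟨Mv, hMv⟩ := hbv
  exact H (fun ω => u' (φ ω)) (fun ω => v' (φ ω)) (hu'.comp hφX) (hv'.comp hφZ)
    ⟨Mu, fun ω => hMu (φ ω)⟩ ⟨Mv, fun ω => hMv (φ ω)⟩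

/-- **Backward transport**: the covariance bound for `(mX', mZ')` under `μ.map φ` gives the covariance bound for
the pulled-back algebras `(φ⁻¹ mX', φ⁻¹ mZ')` under `μ` (Doob–Dynkin: a `φ⁻¹ mX'`-measurable real statistic is
`u' ∘ φ` with `u'` `mX'`-measurable, truncated to the same bound). -/
theorem covBound_comap_of_map (hφ : Measurable φ) (hX' : mX' ≤ mβ) (hZ' : mZ' ≤ mβ) {ρ : ℝ}
    (H' : ∀ u' v' : β → ℝ, Measurable[mX'] u' → Measurable[mZ'] v' →
      (∃ M : ℝ, ∀ x, |u' x| ≤ M) → (∃ M : ℝ, ∀ x, |v' x| ≤ M) →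
      |(∫ x, u' x * v' x ∂(μ.map φ)) - (∫ x, u' x ∂(μ.map φ)) * (∫ x, v' x ∂(μ.map φ))| ≤
        ρ * Real.sqrt (∫ x, (u' x - ∫ x', u' x' ∂(μ.map φ)) ^ 2 ∂(μ.map φ))
          * Real.sqrt (∫ x, (v' x - ∫ x', v' x' ∂(μ.map φ)) ^ 2 ∂(μ.map φ)))
    {u v : Ω → ℝ} (hu : Measurable[mX'.comap φ] u) (hv : Measurable[mZ'.comap φ] v)
    (hbu : ∃ M : ℝ, ∀ ω, |u ω| ≤ M) (hbv : ∃ M : ℝ, ∀ ω, |v ω| ≤ M) :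
    |(∫ ω, u ω * v ω ∂μ) - (∫ ω, u ω ∂μ) * (∫ ω, v ω ∂μ)| ≤
      ρ * Real.sqrt (∫ ω, (u ω - ∫ ω', u ω' ∂μ) ^ 2 ∂μ) * Real.sqrt (∫ ω, (v ω - ∫ ω', v ω' ∂μ) ^ 2 ∂μ) := by
  obtain ⟨Mu, hMu⟩ := hbu
  obtain ⟨Mv, hMv⟩ := hbv
  -- Doob–Dynkin factorisations through `φ`, truncated
  obtain ⟨u₀, hu₀, hu_eq⟩ := @Measurable.exists_eq_measurable_comp Ω β ℝ mX' φ u _ _ _ hu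
  obtain ⟨v₀, hv₀, hv_eq⟩ := @Measurable.exists_eq_measurable_comp Ω β ℝ mZ' φ v _ _ _ hv
  obtain ⟨u', hu'sm, hu'M, hu'eq⟩ := exists_stronglyMeasurable_truncation (m := mX') hu₀.stronglyMeasurable Mu
  obtain ⟨v', hv'sm, hv'M, hv'eq⟩ := exists_stronglyMeasurable_truncation (m := mZ') hv₀.stronglyMeasurable Mv
  have hcu : ∀ ω, u' (φ ω) = u ω := fun ω => by
    have h1 : u ω = u₀ (φ ω) := congrFun hu_eq ω
    rw [h1]; exact hu'eq _ (h1 ▸ hMu ω)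
  have hcv : ∀ ω, v' (φ ω) = v ω := fun ω => by
    have h1 : v ω = v₀ (φ ω) := congrFun hv_eq ω
    rw [h1]; exact hv'eq _ (h1 ▸ hMv ω)
  have hu'm : Measurable u' := (hu'sm.mono hX').measurable
  have hv'm : Measurable v' := (hv'sm.mono hZ').measurable
  -- the bound under `μ.map φ`, transported back
  have hH := H' u' v' hu'sm.measurable hv'sm.measurable ⟨|Mu|, hu'M⟩ ⟨|Mv|, hv'M⟩
  have e1 : ∫ x, u' x * v' x ∂(μ.map φ) = ∫ ω, u ω * v ω ∂μ := by
    have e : ∫ x, u' x * v' x ∂(μ.map φ) = ∫ ω, u' (φ ω) * v' (φ ω) ∂μ :=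
      integral_map_of_stronglyMeasurable hφ (hu'm.mul hv'm).stronglyMeasurable
    rw [e]
    exact integral_congr_ae (ae_of_all _ fun ω => by simp only [hcu, hcv])
  have e2 : ∫ x, u' x ∂(μ.map φ) = ∫ ω, u ω ∂μ := by
    have e : ∫ x, u' x ∂(μ.map φ) = ∫ ω, u' (φ ω) ∂μ :=
      integral_map_of_stronglyMeasurable hφ hu'm.stronglyMeasurable
    rw [e]
    exact integral_congr_ae (ae_of_all _ fun ω => by simp only [hcu])
  have e3 : ∫ x, v' x ∂(μ.map φ) = ∫ ω, v ω ∂μ := by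
    have e : ∫ x, v' x ∂(μ.map φ) = ∫ ω, v' (φ ω) ∂μ :=
      integral_map_of_stronglyMeasurable hφ hv'm.stronglyMeasurable
    rw [e]
    exact integral_congr_ae (ae_of_all _ fun ω => by simp only [hcv])
  rw [e1, e2, e3] at hH
  have e4 : ∫ x, (u' x - ∫ ω, u ω ∂μ) ^ 2 ∂(μ.map φ) = ∫ ω, (u ω - ∫ ω, u ω ∂μ) ^ 2 ∂μ := by
    have e : ∫ x, (u' x - ∫ ω, u ω ∂μ) ^ 2 ∂(μ.map φ) = ∫ ω, (u' (φ ω) - ∫ ω, u ω ∂μ) ^ 2 ∂μ :=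
      integral_map_of_stronglyMeasurable hφ ((hu'm.sub measurable_const).pow_const 2).stronglyMeasurable
    rw [e]
    exact integral_congr_ae (ae_of_all _ fun ω => by simp only [hcu])
  have e5 : ∫ x, (v' x - ∫ ω, v ω ∂μ) ^ 2 ∂(μ.map φ) = ∫ ω, (v ω - ∫ ω, v ω ∂μ) ^ 2 ∂μ := by
    have e : ∫ x, (v' x - ∫ ω, v ω ∂μ) ^ 2 ∂(μ.map φ) = ∫ ω, (v' (φ ω) - ∫ ω, v ω ∂μ) ^ 2 ∂μ :=
      integral_map_of_stronglyMeasurable hφ ((hv'm.sub measurable_const).pow_const 2).stronglyMeasurable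
    rw [e]
    exact integral_congr_ae (ae_of_all _ fun ω => by simp only [hcv])
  rw [e4, e5] at hH
  exact hH

end Transport

end Summit.QuantumFields.YangMills.Cruxes.IR.ShellMaxCorr.Tensorisation

end
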